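import Mathlib

/-!
# Crux `GappedShellCensus.FiveFoldRationingR` (stmt-AtomisticToContinuum-18071), line `Sketch` —
# helpers for stub `stub_ffrC5Kills` (angle-budget kills on abstract fan data), part 1

Abstract fan data of a gapped twelve-shell: a Boolean bond relation `bond` on `Fin 12`, fan
triangles `tri` (twenty 3-sets of labels, two triangles per side, bonds are sides of exactly two
triangles, bonded 3-cliques are triangles, flag-connected links) and corner angles.  This file
collects the first combinatorial tools used by the kills:

* the two numerical budgets `3·arccos (81/200) + 2·arccos (1/25) > 2π` (five spokes with two
  non-triangular sectors overshoot) and `3·arccos (1/4) + 2·arccos (807/2000) < 2π` (the sibling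
  crux's `3T+Q` / `3T+2H` budget), from the exact values of `cos (3·arccos c)` and
  `cos (2·arccos c)` — registered sub-goal `stub_ffrC5KillsBudget`;
* small `Finset` facts about 3-sets and about the two triangles through a side (`ffrK_third`,
  `ffrK_fib_cases`), and the face condition at a non-bond side (`ffrK_tbs`);
* `ffrK_link3`: the link of a label of bond-degree `≥ 4` contains no 3-cycle (a closed set of
  three triangles at `v` would be the whole star of `v`, by flag-connectedness, leaving room for at
  most three bond partners).
-/

noncomputable section

namespace Summit.AtomisticToContinuum.Crystallization.Theorems

open Real

/-! ### The two angle budgets -/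

/-- **Lower budget.** `2π < 3·arccos (81/200) + 2·arccos (1/25)` (numerically
`6.2832 < 3·1.1539 + 2·1.5308 = 6.5233`): with `a = arccos (81/200)`, `b = arccos (1/25)` one has
`cos (3a − π) = 3·(81/200) − 4·(81/200)³ ≈ 0.9493 < 0.9968 = 1 − 2/625 = cos (π − 2b)` with both
arguments in `[0, π]`, so `π − 2b < 3a − π`. [folklore] -/
theorem ffrK_num_lower : 2 * π < 3 * arccos (81 / 200) + 2 * arccos (1 / 25) := by
  -- adapted from `three_arccos_quarter_add_two_arccos_807_lt_two_pi` of the sibling crux's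
  -- `GappedShellCensusShellTrichotomyStubKill3TQ.lean`
  have ha1 : π / 3 < arccos (81 / 200) := by
    rw [← arccos_cos (x := π / 3) (by positivity) (by linarith [pi_pos]), cos_pi_div_three]
    exact arccos_lt_arccos (by norm_num) (by norm_num) (by norm_num)
  have ha2 : arccos (81 / 200) < π / 2 := by
    rw [← arccos_zero]
    exact arccos_lt_arccos (by norm_num) (by norm_num) (by norm_num)
  have hb2 : arccos (1 / 25) < π / 2 := by
    rw [← arccos_zero]
    exact arccos_lt_arccos (by norm_num) (by norm_num) (by norm_num)
  have hb0 : 0 < arccos (1 / 25) := arccos_pos.2 (by norm_num)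
  set a := arccos (81 / 200) with ha
  set b := arccos (1 / 25) with hb
  have hX0 : 0 ≤ 3 * a - π := by linarith
  have hXπ : 3 * a - π ≤ π := by linarith
  have hY0 : 0 ≤ π - 2 * b := by linarith
  have hYπ : π - 2 * b ≤ π := by linarith
  have hcX : cos (3 * a - π) = 3 * (81 / 200) - 4 * (81 / 200) ^ 3 := by
    rw [cos_sub_pi, cos_three_mul, ha, cos_arccos (by norm_num) (by norm_num)]; ring
  have hcY : cos (π - 2 * b) = 1 - 2 * (1 / 25) ^ 2 := by
    rw [cos_pi_sub, cos_two_mul, hb, cos_arccos (by norm_num) (by norm_num)]; ring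
  have hlt : cos (3 * a - π) < cos (π - 2 * b) := by rw [hcX, hcY]; norm_num
  have key : π - 2 * b < 3 * a - π := by
    by_contra h
    push Not at h
    have := Real.strictAntiOn_cos.antitoneOn (Set.mem_Icc.2 ⟨hX0, hXπ⟩) (Set.mem_Icc.2 ⟨hY0, hYπ⟩) h
    linarith
  linarith

/-- **Upper budget.** `3·arccos (1/4) + 2·arccos (807/2000) < 2π` (numerically
`3.9543 + 2.3109 = 6.2652 < 6.2832`), from `cos (3·arccos (1/4)) = −11/16` and
`cos (2·arccos (807/2000)) = −1348751/2000000`. [folklore] -/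
theorem ffrK_num_upper : 3 * arccos (1 / 4) + 2 * arccos (807 / 2000) < 2 * π := by
  -- adapted from `three_arccos_quarter_add_two_arccos_807_lt_two_pi` of the sibling crux's
  -- `GappedShellCensusShellTrichotomyStubKill3TQ.lean` (private there)
  have ha1 : π / 3 < arccos (1 / 4) := by
    rw [← arccos_cos (x := π / 3) (by positivity) (by linarith [pi_pos]), cos_pi_div_three]
    exact arccos_lt_arccos (by norm_num) (by norm_num) (by norm_num)
  have ha2 : arccos (1 / 4) < π / 2 := by
    rw [← arccos_zero]
    exact arccos_lt_arccos (by norm_num) (by norm_num) (by norm_num)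
  have hb1 : π / 3 < arccos (807 / 2000) := by
    rw [← arccos_cos (x := π / 3) (by positivity) (by linarith [pi_pos]), cos_pi_div_three]
    exact arccos_lt_arccos (by norm_num) (by norm_num) (by norm_num)
  have hb2 : arccos (807 / 2000) < π / 2 := by
    rw [← arccos_zero]
    exact arccos_lt_arccos (by norm_num) (by norm_num) (by norm_num)
  set a := arccos (1 / 4) with ha
  set b := arccos (807 / 2000) with hb
  have hx0 : 0 ≤ 2 * π - 3 * a := by linarith
  have hxπ : 2 * π - 3 * a ≤ π := by linarith
  have hy0 : 0 ≤ 2 * b := by linarith [pi_pos]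
  have hyπ : 2 * b ≤ π := by linarith
  have hcx : cos (2 * π - 3 * a) = -11 / 16 := by
    rw [cos_sub, cos_two_pi, sin_two_pi, cos_three_mul, ha, cos_arccos (by norm_num) (by norm_num)]
    norm_num
  have hcy : cos (2 * b) = -1348751 / 2000000 := by
    rw [cos_two_mul, hb, cos_arccos (by norm_num) (by norm_num)]; norm_num
  have hlt : cos (2 * π - 3 * a) < cos (2 * b) := by rw [hcx, hcy]; norm_num
  have key : 2 * b < 2 * π - 3 * a := by
    by_contra h
    push Not at h
    have := Real.strictAntiOn_cos.antitoneOn (Set.mem_Icc.2 ⟨hx0, hxπ⟩) (Set.mem_Icc.2 ⟨hy0, hyπ⟩) h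
    linarith
  linarith

/-- `4·arccos (1/4) < 2π`, since `arccos (1/4) < π/2`. [folklore] -/
theorem ffrK_num_four : 4 * arccos (1 / 4) < 2 * π := by
  have : arccos (1 / 4) < π / 2 := by
    rw [← arccos_zero]
    exact arccos_lt_arccos (by norm_num) (by norm_num) (by norm_num)
  linarith

/-- `arccos (81/200) ≤ arccos (1/25)` (`arccos` is antitone). [folklore] -/
theorem ffrK_num_mono : arccos (81 / 200) ≤ arccos (1 / 25) :=
  arccos_le_arccos (by norm_num)

/-- **Registered sub-goal (the two angle budgets of the kills).** `2π < 3·arccos (81/200) +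
2·arccos (1/25)` (a five-valent label with two non-triangular sectors overshoots) and
`3·arccos (1/4) + 2·arccos (807/2000) < 2π` (a four-valent label with three bond triangles
undershoots). [folklore] -/
theorem stub_ffrC5KillsBudget :
    2 * Real.pi < 3 * Real.arccos (81 / 200) + 2 * Real.arccos (1 / 25) ∧
      3 * Real.arccos (1 / 4) + 2 * Real.arccos (807 / 2000) < 2 * Real.pi :=
  ⟨ffrK_num_lower, ffrK_num_upper⟩

/-! ### Small `Finset` facts -/

/-- In a two-element set, besides a given member `X` there is exactly one other member.
[folklore] -/
theorem ffrK_pair_cases {β : Type*} [DecidableEq β] {s : Finset β} (hs : s.card = 2) {X : β}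
    (hX : X ∈ s) : ∃ Y ∈ s, Y ≠ X ∧ ∀ Z ∈ s, Z = X ∨ Z = Y := by
  obtain ⟨x, y, hxy, rfl⟩ := Finset.card_eq_two.1 hs
  simp only [Finset.mem_insert, Finset.mem_singleton] at hX
  rcases hX with h | h
  · refine ⟨y, by simp, fun e => hxy (e.trans h).symm, fun Z hZ => ?_⟩
    rw [h]
    simpa using hZ
  · refine ⟨x, by simp, fun e => hxy (e.trans h), fun Z hZ => ?_⟩
    rw [h]
    simpa [or_comm] using hZ

/-- A 3-set through two distinct points `v, w` is `{v, w, u}` for a third point `u`. [folklore] -/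
theorem ffrK_third {S : Finset (Fin 12)} (hS : S.card = 3) {v w : Fin 12} (hv : v ∈ S) (hw : w ∈ S)
    (hvw : v ≠ w) : ∃ u, u ≠ v ∧ u ≠ w ∧ S = {v, w, u} := by
  have h1 : (S.erase v).card = 2 := by rw [Finset.card_erase_of_mem hv, hS]
  have hw' : w ∈ S.erase v := Finset.mem_erase.2 ⟨hvw.symm, hw⟩
  have h2 : ((S.erase v).erase w).card = 1 := by rw [Finset.card_erase_of_mem hw', h1]
  obtain ⟨u, hu⟩ := Finset.card_eq_one.1 h2
  have huR : u ∈ (S.erase v).erase w := by rw [hu]; exact Finset.mem_singleton_self u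
  refine ⟨u, (Finset.mem_erase.1 (Finset.mem_erase.1 huR).2).1, (Finset.mem_erase.1 huR).1, ?_⟩
  calc S = insert v (S.erase v) := (Finset.insert_erase hv).symm
    _ = insert v (insert w ((S.erase v).erase w)) := by rw [Finset.insert_erase hw']
    _ = {v, w, u} := by rw [hu]

/-- `{a, b, c} = {a, c, b}`. [folklore] -/
theorem ffrK_swap (a b c : Fin 12) : ({a, b, c} : Finset (Fin 12)) = {a, c, b} := by
  rw [Finset.pair_comm]

/-- `{a, b, c} = {b, c, a}`. [folklore] -/
theorem ffrK_rot (a b c : Fin 12) : ({a, b, c} : Finset (Fin 12)) = {b, c, a} := by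
  rw [Finset.insert_comm, Finset.pair_comm]

/-- A pairwise bonded triple is a bond triangle: any two distinct members of `{p, q, r}` are
bonded. [folklore] -/
theorem ffrK_fb_triple (bond : Fin 12 → Fin 12 → Bool) (bond_symm : ∀ v w, bond v w = bond w v)
    (p q r : Fin 12) (hpq : bond p q = true) (hqr : bond q r = true) (hpr : bond p r = true) :
    ∀ y ∈ ({p, q, r} : Finset (Fin 12)), ∀ z ∈ ({p, q, r} : Finset (Fin 12)),
      y ≠ z → bond y z = true := by
  -- adapted from `bond_of_mem_triple` of `GappedShellCensusShellTrichotomyStubKill3TQ.lean`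
  intro y hy z hz hne
  simp only [Finset.mem_insert, Finset.mem_singleton] at hy hz
  rcases hy with rfl | rfl | rfl <;> rcases hz with rfl | rfl | rfl <;>
    first
    | exact absurd rfl hne
    | assumption
    | (rw [bond_symm]; assumption)

/-! ### The two triangles through a side -/

/-- The triangles containing the side `{v, w}` are the triangles at `v` through `w`. [folklore] -/
theorem ffrK_filter_pair (tri : Finset (Finset (Fin 12))) (v w : Fin 12) :
    (tri.filter fun S' => ({v, w} : Finset (Fin 12)) ⊆ S') =
      (tri.filter fun S => v ∈ S).filter fun S => w ∈ S := by
  ext S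
  simp only [Finset.mem_filter, Finset.insert_subset_iff, Finset.singleton_subset_iff, and_assoc]

/-- Two triangles at `v` pass through every other vertex `w` of a triangle at `v`. [folklore] -/
theorem ffrK_fib_two (tri : Finset (Finset (Fin 12)))
    (two_per_side : ∀ S ∈ tri, ∀ s ⊆ S, s.card = 2 → (tri.filter fun S' => s ⊆ S').card = 2)
    {S : Finset (Fin 12)} (hS : S ∈ tri) {v w : Fin 12} (hv : v ∈ S) (hw : w ∈ S) (hvw : v ≠ w) :
    ((tri.filter fun S => v ∈ S).filter fun S => w ∈ S).card = 2 := by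
  rw [← ffrK_filter_pair]
  exact two_per_side S hS {v, w}
    (Finset.insert_subset_iff.2 ⟨hv, Finset.singleton_subset_iff.2 hw⟩) (Finset.card_pair hvw)

/-- Two triangles at `v` pass through every bond partner `w` of `v`. [folklore] -/
theorem ffrK_fib_two_bond (bond : Fin 12 → Fin 12 → Bool) (tri : Finset (Finset (Fin 12)))
    (bond_side : ∀ v w, bond v w = true →
      (tri.filter fun S' => ({v, w} : Finset (Fin 12)) ⊆ S').card = 2)
    {v w : Fin 12} (h : bond v w = true) :
    ((tri.filter fun S => v ∈ S).filter fun S => w ∈ S).card = 2 := by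
  rw [← ffrK_filter_pair]
  exact bond_side v w h

/-- **The other triangle through a side.** For a triangle `X` through `v ≠ w` there is a second
triangle `Y ≠ X` through `v, w`, and every triangle through `v, w` is `X` or `Y`. [folklore] -/
theorem ffrK_fib_cases (tri : Finset (Finset (Fin 12)))
    (two_per_side : ∀ S ∈ tri, ∀ s ⊆ S, s.card = 2 → (tri.filter fun S' => s ⊆ S').card = 2)
    {X : Finset (Fin 12)} (hX : X ∈ tri) {v w : Fin 12} (hv : v ∈ X) (hw : w ∈ X) (hvw : v ≠ w) :
    ∃ Y ∈ tri, v ∈ Y ∧ w ∈ Y ∧ Y ≠ X ∧ ∀ Z ∈ tri, v ∈ Z → w ∈ Z → Z = X ∨ Z = Y := by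
  have h2 := ffrK_fib_two tri two_per_side hX hv hw hvw
  obtain ⟨Y, hY, hYX, hall⟩ := ffrK_pair_cases h2 (X := X)
    (by simp only [Finset.mem_filter]; exact ⟨⟨hX, hv⟩, hw⟩)
  simp only [Finset.mem_filter] at hY
  exact ⟨Y, hY.1.1, hY.1.2, hY.2, hYX, fun Z hZ hvZ hwZ =>
    hall Z (by simp only [Finset.mem_filter]; exact ⟨⟨hZ, hvZ⟩, hwZ⟩)⟩

/-- **Face condition at a non-bond side.** If `{v, x, u}` is a fan triangle and `v x` is not a
bond, then `u` is bonded to `v` and to `x`. [folklore] -/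
theorem ffrK_tbs (bond : Fin 12 → Fin 12 → Bool) (tri : Finset (Finset (Fin 12)))
    (bond_symm : ∀ v w, bond v w = bond w v)
    (two_bond_sides : ∀ S ∈ tri, ∃ a ∈ S, ∀ b ∈ S, b ≠ a → bond a b = true)
    {v x u : Fin 12} (hS : ({v, x, u} : Finset (Fin 12)) ∈ tri) (hxv : x ≠ v) (huv : u ≠ v)
    (hux : u ≠ x) (hvx : bond v x = false) : bond v u = true ∧ bond u x = true := by
  obtain ⟨c, hc, hcb⟩ := two_bond_sides _ hS
  simp only [Finset.mem_insert, Finset.mem_singleton] at hc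
  rcases hc with rfl | rfl | rfl
  · have h := hcb x (by simp) hxv
    rw [hvx] at h
    exact absurd h Bool.false_ne_true
  · have h := hcb v (by simp) hxv.symm
    rw [bond_symm, hvx] at h
    exact absurd h Bool.false_ne_true
  · exact ⟨by rw [bond_symm]; exact hcb v (by simp) huv.symm, hcb x (by simp) hux.symm⟩

/-! ### No 3-cycle in a link -/

/-- **No 3-cycle in the link of a label of bond-degree `≥ 4`.** If the three triangles
`{v,a,x}`, `{v,x,z}`, `{v,z,a}` (with `v, a, x, z` distinct) are fan triangles, they form a set
of triangles at `v` closed under passing through a common side, hence — by flag-connectedness of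
the link — the whole star of `v`; but every bond partner of `v` lies in a triangle at `v`, so `v`
would have at most the three partners `a, x, z`. [folklore] -/
theorem ffrK_link3 (bond : Fin 12 → Fin 12 → Bool) (tri : Finset (Finset (Fin 12)))
    (bond_irrefl : ∀ v, bond v v = false)
    (two_per_side : ∀ S ∈ tri, ∀ s ⊆ S, s.card = 2 → (tri.filter fun S' => s ⊆ S').card = 2)
    (bond_side : ∀ v w, bond v w = true →
      (tri.filter fun S' => ({v, w} : Finset (Fin 12)) ⊆ S').card = 2)
    (link : ∀ v, ∀ A ⊆ tri.filter (fun S => v ∈ S), A.Nonempty →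
      (∀ S ∈ A, ∀ S' ∈ tri, v ∈ S' → (S ∩ S').card = 2 → S' ∈ A) → A = tri.filter fun S => v ∈ S)
    {v a x z : Fin 12} (hP : 4 ≤ (Finset.univ.filter fun w => bond v w = true).card)
    (hav : a ≠ v) (hxv : x ≠ v) (hzv : z ≠ v) (hax : a ≠ x) (hxz : x ≠ z) (hza : z ≠ a)
    (h1 : ({v, a, x} : Finset (Fin 12)) ∈ tri) (h2 : ({v, x, z} : Finset (Fin 12)) ∈ tri)
    (h3 : ({v, z, a} : Finset (Fin 12)) ∈ tri) : False := by
  -- two triangles through `v, w` exhaust the triangles through `v, w`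
  have two : ∀ (w : Fin 12) (X Y : Finset (Fin 12)), X ∈ tri → Y ∈ tri → v ∈ X → w ∈ X →
      v ∈ Y → w ∈ Y → X ≠ Y → v ≠ w → ∀ S' ∈ tri, v ∈ S' → w ∈ S' → S' = X ∨ S' = Y := by
    intro w X Y hX hY hvX hwX hvY hwY hXY hvw S' hS' hvS' hwS'
    obtain ⟨Y', -, -, -, -, hall⟩ := ffrK_fib_cases tri two_per_side hX hvX hwX hvw
    have hYY' : Y = Y' := by
      rcases hall Y hY hvY hwY with h | h
      · exact absurd h hXY.symm
      · exact h
    rw [hYY']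
    exact hall S' hS' hvS' hwS'
  have hne12 : ({v, a, x} : Finset (Fin 12)) ≠ {v, x, z} := fun h => by
    have : a ∈ ({v, x, z} : Finset (Fin 12)) := h ▸ (by simp)
    simp only [Finset.mem_insert, Finset.mem_singleton] at this
    rcases this with h | h | h
    · exact hav h
    · exact hax h
    · exact hza h.symm
  have hne23 : ({v, x, z} : Finset (Fin 12)) ≠ {v, z, a} := fun h => by
    have : x ∈ ({v, z, a} : Finset (Fin 12)) := h ▸ (by simp)
    simp only [Finset.mem_insert, Finset.mem_singleton] at this
    rcases this with h | h | h
    · exact hxv h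
    · exact hxz h
    · exact hax h.symm
  have hne31 : ({v, z, a} : Finset (Fin 12)) ≠ {v, a, x} := fun h => by
    have : z ∈ ({v, a, x} : Finset (Fin 12)) := h ▸ (by simp)
    simp only [Finset.mem_insert, Finset.mem_singleton] at this
    rcases this with h | h | h
    · exact hzv h
    · exact hza h
    · exact hxz h.symm
  set A : Finset (Finset (Fin 12)) := {{v, a, x}, {v, x, z}, {v, z, a}} with hAdef
  have hAsub : A ⊆ tri.filter fun S => v ∈ S := by
    intro S hS
    simp only [hAdef, Finset.mem_insert, Finset.mem_singleton] at hS
    rw [Finset.mem_filter]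
    rcases hS with rfl | rfl | rfl
    · exact ⟨h1, by simp⟩
    · exact ⟨h2, by simp⟩
    · exact ⟨h3, by simp⟩
  have hAne : A.Nonempty := ⟨_, Finset.mem_insert_self _ _⟩
  have hclosed : ∀ S ∈ A, ∀ S' ∈ tri, v ∈ S' → (S ∩ S').card = 2 → S' ∈ A := by
    intro S hS S' hS' hvS' hcard
    obtain ⟨p, q, hpq, hpq'⟩ := Finset.card_eq_two.1 hcard
    have hvin : v ∈ S ∩ S' := Finset.mem_inter.2 ⟨(Finset.mem_filter.1 (hAsub hS)).2, hvS'⟩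
    obtain ⟨w, hw, hwv⟩ : ∃ w ∈ S ∩ S', w ≠ v := by
      rw [hpq'] at hvin ⊢
      simp only [Finset.mem_insert, Finset.mem_singleton] at hvin
      rcases hvin with h | h
      · exact ⟨q, by simp, fun e => hpq (e.trans h).symm⟩
      · exact ⟨p, by simp, fun e => hpq (e.trans h)⟩
    have hwS : w ∈ S := (Finset.mem_inter.1 hw).1
    have hwS' : w ∈ S' := (Finset.mem_inter.1 hw).2
    simp only [hAdef, Finset.mem_insert, Finset.mem_singleton] at hS ⊢
    have hw3 : w = a ∨ w = x ∨ w = z := by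
      rcases hS with rfl | rfl | rfl <;>
        simp only [Finset.mem_insert, Finset.mem_singleton] at hwS <;> tauto
    rcases hw3 with hw | hw | hw <;> rw [hw] at hwS'
    · rcases two a {v, a, x} {v, z, a} h1 h3 (by simp) (by simp) (by simp) (by simp) hne31.symm
          hav.symm S' hS' hvS' hwS' with h | h
      · exact Or.inl h
      · exact Or.inr (Or.inr h)
    · rcases two x {v, a, x} {v, x, z} h1 h2 (by simp) (by simp) (by simp) (by simp) hne12
          hxv.symm S' hS' hvS' hwS' with h | h
      · exact Or.inl h
      · exact Or.inr (Or.inl h)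
    · rcases two z {v, x, z} {v, z, a} h2 h3 (by simp) (by simp) (by simp) (by simp) hne23
          hzv.symm S' hS' hvS' hwS' with h | h
      · exact Or.inr (Or.inl h)
      · exact Or.inr (Or.inr h)
  have hAeq := link v A hAsub hAne hclosed
  -- every bond partner of `v` lies in a member of `A`
  have hPsub : (Finset.univ.filter fun w => bond v w = true) ⊆ {a, x, z} := by
    intro p hp
    rw [Finset.mem_filter] at hp
    have hcard := bond_side v p hp.2
    obtain ⟨S, hS⟩ : (tri.filter fun S' => ({v, p} : Finset (Fin 12)) ⊆ S').Nonempty := by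
      rw [← Finset.card_pos, hcard]; norm_num
    rw [Finset.mem_filter, Finset.insert_subset_iff, Finset.singleton_subset_iff] at hS
    have hSA : S ∈ A := by rw [hAeq]; exact Finset.mem_filter.2 ⟨hS.1, hS.2.1⟩
    have hpv : p ≠ v := fun h => by
      rw [h, bond_irrefl] at hp
      exact Bool.false_ne_true hp.2
    have hpS := hS.2.2
    simp only [hAdef, Finset.mem_insert, Finset.mem_singleton] at hSA
    rcases hSA with rfl | rfl | rfl <;>
      simp only [Finset.mem_insert, Finset.mem_singleton] at hpS ⊢ <;> tauto
  have h3le : ({a, x, z} : Finset (Fin 12)).card ≤ 3 := Finset.card_le_three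
  have := Finset.card_le_card hPsub
  omega

end Summit.AtomisticToContinuum.Crystallization.Theorems

end
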